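import Literature.Computability.Complexity.FKPointLocationProtocol
import HarnessLib

/-!
# Fournier–Koiran point location, VII: the lifted sign queries test the projected point

Topic `Literature/Computability/Complexity`, grouping namespace `FKPointLocation`. The semantic core
of Lemma 2 of Fournier–Koiran (ICALP 2000 = LIP RR-1999-21, §2.1) for the protocol of
`FKPointLocationProtocol.lean`: a level-local affine test `φ`, lifted through the apex records of
the completed levels (`liftAll`, `FKPointLocationSearch.lean`) and evaluated by the sign oracle AT
THE INPUT `x̂`, has the sign of `φ` AT THE PROJECTED POINT `x^{(j)}` (`Cert.xProj`):
`sign_aff_liftAll` (under partial validity `Cert.ValidBelow`, by `sign_aff_liftForm` and the ray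
form `Cert.xProj_succ_eq_ray` of the projection). Also: the values of the local forms
(`aff_bsForm`, `aff_geForm`, `aff_leForm`, `aff_faForm`) and `decide_nonneg_eq_of_sign_eq`.

## References

* H. Fournier, P. Koiran, *Lower bounds are not easier over the reals: inside PH*, ICALP 2000,
  LNCS 1853 = LIP RR-1999-21, §2.1 Lemma 2 and Step k. [FournierKoiran2000]
-/

namespace Literature.Computability.Complexity

namespace FKPointLocation

open Finset

variable {D : ℕ}

/-! ### Signs and oracle bits -/

/-- Equal signs give equal oracle bits `[0 ≤ ·]`. [folklore] -/
theorem decide_nonneg_eq_of_sign_eq {u v : ℝ} (h : SignType.sign u = SignType.sign v) :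
    decide (0 ≤ u) = decide (0 ≤ v) := by
  rcases lt_trichotomy u 0 with hu | hu | hu
  · rw [sign_neg hu] at h
    have hv : v < 0 := sign_eq_neg_one_iff.1 h.symm
    rw [decide_eq_false (not_le.2 hu), decide_eq_false (not_le.2 hv)]
  · subst hu
    rw [sign_zero] at h
    have hv : v = 0 := sign_eq_zero_iff.1 h.symm
    rw [hv]
  · rw [sign_pos hu] at h
    have hv : 0 < v := sign_eq_one_iff.1 h.symm
    rw [decide_eq_true hu.le, decide_eq_true hv.le]

/-! ### Values of the local forms -/

/-- `lin` of a one-hot vector with coefficient `c`. [folklore] -/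
theorem lin_ite_single (i : Fin D) (c : ℤ) (y : Fin D → ℝ) :
    lin (fun i' => if i' = i then c else 0) y = c * y i := by
  classical
  simp only [lin]
  rw [sum_eq_single i]
  · simp
  · intro j _ hj; simp [hj]
  · simp

/-- Value of the binary-search form. [cite: FournierKoiran2000, §2.1 Step 1] -/
theorem aff_bsForm (i : Fin D) (k acc : ℕ) (y : Fin D → ℝ) :
    aff (bsForm i k acc) y = 2 ^ k * y i + 2 ^ k - 2 * acc - 1 := by
  rw [aff, bsForm, lin_ite_single]; push_cast; ring

/-- The binary-search form tests `-1 + (2 acc + 1)/2^k ≤ y_i`. [cite: FournierKoiran2000, §2.1 Step 1] -/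
theorem aff_bsForm_nonneg_iff (i : Fin D) (k acc : ℕ) (y : Fin D → ℝ) :
    0 ≤ aff (bsForm i k acc) y ↔ (-1 : ℝ) + (2 * acc + 1) / 2 ^ k ≤ y i := by
  rw [aff_bsForm]
  have hp : (0 : ℝ) < 2 ^ k := by positivity
  constructor
  · intro h
    rw [← sub_nonneg]
    have : y i - (-1 + (2 * acc + 1) / 2 ^ k) = (2 ^ k * y i + 2 ^ k - 2 * acc - 1) / 2 ^ k := by
      field_simp; ring
    rw [this]; positivity
  · intro h
    have := mul_le_mul_of_nonneg_left h hp.le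
    rw [mul_add, mul_div_cancel₀ _ hp.ne'] at this
    linarith

/-- Value of the `≥` equality-test form for the apex `s = σ/d`: `d (y_i - s_i)`. [cite: FournierKoiran2000, §2.1] -/
theorem aff_geForm (apex : (Fin D → ℤ) × ℕ) (hd : 0 < apex.2) (i : Fin D) (y : Fin D → ℝ) :
    aff (geForm apex i) y = apex.2 * (y i - (apex.1 i : ℝ) / apex.2) := by
  have : (apex.2 : ℝ) ≠ 0 := by exact_mod_cast hd.ne'
  rw [aff, geForm, lin_ite_single]; push_cast; field_simp; ring

/-- Value of the `≤` equality-test form: `d (s_i - y_i)`. [cite: FournierKoiran2000, §2.1] -/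
theorem aff_leForm (apex : (Fin D → ℤ) × ℕ) (hd : 0 < apex.2) (i : Fin D) (y : Fin D → ℝ) :
    aff (leForm apex i) y = apex.2 * ((apex.1 i : ℝ) / apex.2 - y i) := by
  have : (apex.2 : ℝ) ≠ 0 := by exact_mod_cast hd.ne'
  rw [aff, leForm, lin_ite_single]; push_cast; field_simp; ring

/-- Value of the facet-comparison form (`c ≠ i`): with `s = σ/d`, `ν_k = 1 - ε_k s_k`,
`aff = d² (ν_i ε_c (y_c - s_c) - ν_c ε_i (y_i - s_i))`. [cite: FournierKoiran2000, §2.1] -/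
theorem aff_faForm (apex : (Fin D → ℤ) × ℕ) (hd : 0 < apex.2) (εc εi : ℤ) {c i : Fin D} (hci : c ≠ i)
    (y : Fin D → ℝ) :
    aff (faForm apex εc εi c i) y =
      (apex.2 : ℝ) ^ 2 *
        ((1 - εi * ((apex.1 i : ℝ) / apex.2)) * (εc * (y c - (apex.1 c : ℝ) / apex.2)) -
          (1 - εc * ((apex.1 c : ℝ) / apex.2)) * (εi * (y i - (apex.1 i : ℝ) / apex.2))) := by
  classical
  have hd' : (apex.2 : ℝ) ≠ 0 := by exact_mod_cast hd.ne'
  simp only [aff, faForm, lin]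
  have hsplit : ∀ i' : Fin D, (((if i' = c then (apex.2 - εi * apex.1 i) * εc * apex.2 else 0) +
      (if i' = i then -((apex.2 - εc * apex.1 c) * εi * apex.2) else 0) : ℤ) : ℝ) * y i' =
      (if i' = c then ((apex.2 - εi * apex.1 i) * εc * apex.2 : ℤ) * y c else 0) +
      (if i' = i then (-((apex.2 - εc * apex.1 c) * εi * apex.2) : ℤ) * y i else 0) := by
    intro i'
    by_cases h1 : i' = c
    · subst h1; simp [hci]
    · by_cases h2 : i' = i
      · subst h2; simp [h1]
      · simp [h1, h2]
  simp_rw [hsplit]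
  rw [sum_add_distrib, sum_ite_eq' univ c, sum_ite_eq' univ i]
  simp only [mem_univ, if_true]
  push_cast
  field_simp
  ring

/-! ### The lifted queries test the projected point -/

namespace Cert

variable {Γ : Cert D} {xh : Fin D → ℝ} {J' : ℕ}

/-- An apex record MATCHES level `k` of a certificate: positive denominator, same point, same exit
data. [folklore] -/
def Matches (A : ApexRec D) (Γ : Cert D) (k : ℕ) : Prop :=
  0 < A.d ∧ A.pt = Γ.sR k ∧ A.i₀ = Γ.istar k ∧ A.ε = Γ.εstar k

/-- **Ray form of the projection.** For `j < J'` under partial validity, the projected point is the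
image of `x^{(j)}` under the map of `sign_aff_liftForm`:
`x^{(j+1)} = s + ((ε - s_{i*})/(y_{i*} - s_{i*})) (y - s)`. [cite: FournierKoiran2000, §2.1 Lemma 2] -/
theorem xProj_succ_eq_ray (hV : Γ.ValidBelow xh J') {j : ℕ} (hj : j < J')
    (hc : 1 ≤ j → |Γ.xProj xh j (Γ.istar j)| ≤ 1) :
    Γ.xProj xh (j + 1) = Γ.sR j +
      (((Γ.εstar j : ℝ) - Γ.sR j (Γ.istar j)) / (Γ.xProj xh j (Γ.istar j) - Γ.sR j (Γ.istar j))) •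
        (Γ.xProj xh j - Γ.sR j) := by
  obtain ⟨hd0, hεd, hεε, -, -, -⟩ := exit_facts_of_validBelow hV hj hc
  have habs : |Γ.xProj xh j (Γ.istar j) - Γ.sR j (Γ.istar j)| ≠ 0 := abs_ne_zero.2 hd0
  have hcoef : (1 - (Γ.εstar j : ℝ) * Γ.sR j (Γ.istar j)) / |Γ.xProj xh j (Γ.istar j) - Γ.sR j (Γ.istar j)| =
      ((Γ.εstar j : ℝ) - Γ.sR j (Γ.istar j)) / (Γ.xProj xh j (Γ.istar j) - Γ.sR j (Γ.istar j)) := by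
    rw [div_eq_div_iff habs hd0, ← hεd]
    linear_combination (-(Γ.xProj xh j (Γ.istar j) - Γ.sR j (Γ.istar j))) * hεε
  rw [xProj_succ, exitParam, hcoef]

/-- The forward-ray sign condition of `sign_aff_liftForm` holds at `x^{(j)}` for a matching record.
[cite: FournierKoiran2000, §2.1] -/
theorem ray_sign_of_matches (hV : Γ.ValidBelow xh J') {j : ℕ} (hj : j < J')
    (hc : 1 ≤ j → |Γ.xProj xh j (Γ.istar j)| ≤ 1) {A : ApexRec D} (hA : Matches A Γ j) :
    SignType.sign (Γ.xProj xh j A.i₀ - A.pt A.i₀) = SignType.sign ((A.ε * A.d - A.σ A.i₀ : ℤ) : ℝ) ∧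
    (A.ε : ℤ) * A.d - A.σ A.i₀ ≠ 0 := by
  obtain ⟨hd, hpt, hi, hε⟩ := hA
  rw [hi, hpt, hε]
  obtain ⟨hd0, hεd, hεε, hν, -, -⟩ := exit_facts_of_validBelow hV hj hc
  have hdR : (0 : ℝ) < A.d := by exact_mod_cast hd
  have hσ : (A.σ (Γ.istar j) : ℝ) = A.d * Γ.sR j (Γ.istar j) := by
    have := congrFun hpt (Γ.istar j)
    rw [ApexRec.pt] at this
    field_simp at this
    linarith [this]
  have hE : ((Γ.εstar j * A.d - A.σ (Γ.istar j) : ℤ) : ℝ) =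
      A.d * ((Γ.εstar j : ℝ) * (1 - (Γ.εstar j : ℝ) * Γ.sR j (Γ.istar j))) := by
    push_cast
    rw [hσ]
    linear_combination ((A.d : ℝ) * Γ.sR j (Γ.istar j)) * hεε
  constructor
  · rw [hE, sign_mul, sign_pos hdR, one_mul, sign_mul, sign_pos hν, mul_one]
    -- `sign (y - s) = sign ε` since `ε (y - s) = |y - s| > 0`
    rcases hV.exit_sign j hj with ⟨h1, h2⟩ | ⟨h1, h2⟩
    · rw [h2, sign_pos h1]; simp
    · rw [h2, sign_neg h1]; simp
  · intro h0
    have : ((Γ.εstar j * A.d - A.σ (Γ.istar j) : ℤ) : ℝ) = 0 := by exact_mod_cast h0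
    rw [hE] at this
    rcases mul_eq_zero.1 this with h1 | h1
    · exact hdR.ne' h1
    · rcases mul_eq_zero.1 h1 with h2 | h2
      · rcases hV.exit_sign j hj with ⟨-, h3⟩ | ⟨-, h3⟩ <;> simp [h3] at h2
      · exact hν.ne' h2

/-- **The lifted test has at `x̂` the sign of the local test at `x^{(j)}`**: for a list of apex
records matching levels `j-1, j-2, …, 0` (most recent first) of a certificate valid below `j`.
[cite: FournierKoiran2000, §2.1 Lemma 2 and Step k] -/
theorem sign_aff_liftAll (hV : Γ.ValidBelow xh J') :
    ∀ (hs : List (ApexRec D)) (j : ℕ), hs.length = j → j ≤ J' →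
      (∀ k (hk : k < hs.length), Matches hs[k] Γ (j - 1 - k)) →
      ∀ φ : AffForm D,
        SignType.sign (aff (liftAll hs φ) xh) = SignType.sign (aff φ (Γ.xProj xh j))
  | [], j, hlen, _, _, φ => by
    simp at hlen; subst hlen; rfl
  | A :: hs, j, hlen, hj, hmatch, φ => by
    simp only [List.length_cons] at hlen
    have hj' : hs.length = j - 1 := by omega
    have hA : Matches A Γ (j - 1) := by
      have := hmatch 0 (by simp)
      simpa using this
    have hrest : ∀ k (hk : k < hs.length), Matches hs[k] Γ (j - 1 - 1 - k) := by
      intro k hk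
      have := hmatch (k + 1) (by simp; omega)
      simp only [List.getElem_cons_succ] at this
      have e : j - 1 - (k + 1) = j - 1 - 1 - k := by omega
      rw [e] at this
      exact this
    rw [liftAll_cons, sign_aff_liftAll hV hs (j - 1) hj' (by omega) hrest (liftForm A φ)]
    -- now the single lift at level `j - 1`
    have hlt : j - 1 < J' := by omega
    have hcube : 1 ≤ j - 1 → |Γ.xProj xh (j - 1) (Γ.istar (j - 1))| ≤ 1 := fun h1 =>
      (xProj_mem_unitCube_of_validBelow hV (j - 1) hlt.le).2 h1 _
    obtain ⟨hy, hne⟩ := ray_sign_of_matches hV hlt hcube hA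
    rw [sign_aff_liftForm A hA.1 φ _ hy hne]
    have hray := xProj_succ_eq_ray hV hlt hcube
    have e : j - 1 + 1 = j := by omega
    rw [e] at hray
    rw [hray, hA.2.1, hA.2.2.1, hA.2.2.2]

end Cert

end FKPointLocation

end Literature.Computability.Complexity
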